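import Summits.Ventures.LatticeQCDFlow.Exactness.BernsteinInequality
import Summits.Ventures.LatticeQCDFlow.Exactness.IMHCoupledEstimatorBurnInHoeffding
import HarnessLib

/-!
# The equilibrium-variance (Bernstein) error bar for the coupled flow-MCMC estimator:
# `P(|H̄_R − π f| ≥ ε + r^k(c − a)) ≤ 2·exp(−Rε²/(2(Var_π f + 3r^k(c − a)² + (c − a)ε/3))) + R·r^k·p₀`

HONEST FRAMING: exact (Metropolis-corrected) sampling algorithms for lattice gauge theory;
figures of merit are autocorrelation/cost numbers at stated couplings and volumes; no
continuum-physics claim.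

Venture `LatticeQCDFlow` (cell pub-lqcd), topic `Exactness`; FANOUT row 30 (lean-1, GEN-40).  NEW WORK of the cell, general state space
with `MeasurableEq Ω`; sequel to GEN-39's `Exactness/IMHCoupledEstimatorBurnInHoeffding` («NOT CLAIMED: a variance-sensitive (Bernstein)
exponent») using this generation's `Exactness/BernsteinInequality` (`bernstein_avg_abs`).  Setting as there: exact sampler `K = indepMH q w`,
`w` normalised and maximal at `x₀`, `W = w(x₀)`, `r = 1 − 1/W`; CRN pair kernel `K̂`, pair path law from an initial coupling `ν̂` one update
ahead, `p₀ = ν̂(Δᶜ)`; mutually independent pair streams `Z_j` with that law; `a ≤ f ≤ c` measurable; coupled estimates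
`H_{k,N}(Z_j) = f(Y_k) + Σ_{n<N} D_{k+n}`; read-outs `f(Y_k^{(j)})` with common law `ν₂K^k`, mean `m_k = (ν₂K^k) f`, variance `σ_k² = Var_{ν₂K^k} f`.

* §1 **`variance_iterate_bind_indepMH_le`** — THE READ-OUT VARIANCE IS AN EQUILIBRIUM QUANTITY: `Var_{μ₀Kⁿ} f ≤ Var_π f + 3rⁿ(c − a)²` from
  every start `μ₀` (second moment and mean of `f − a` each within `rⁿ`·range of equilibrium, GEN-33 `integral_iterate_bind_indepMH_abs_le`);
  **`crnLag_replica_readout_variance_eq`** — `Var f(Y_k^{(j)}) = σ_k²` [transfer]; **`crnLag_replicas_readout_bernstein_abs`** — Bernstein for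
  the read-outs: `P(|R⁻¹Σ_j f(Y_k^{(j)}) − m_k| ≥ ε) ≤ 2·exp(−Rε²/(2(σ² + (c − a)ε/3)))` for every `σ² ≥ σ_k²`, `σ² > 0`.
* §2 **`crnLag_replicas_burnIn_bernstein_abs`** — `P(|H̄_R − m_k| ≥ ε) ≤ 2·exp(−Rε²/(2(σ² + (c − a)ε/3))) + R·r^k·p₀` (off the event that
  some replica carries a correction — probability `≤ R·r^k·p₀`, GEN-39 — the coupled average IS the read-out average);
  **`crnLag_replicas_burnIn_bernstein_abs_target`** — ABOUT `π f`: `P(|H̄_R − π f| ≥ ε + r^k(c − a)) ≤ 2·exp(−Rε²/(2(σ² + (c − a)ε/3))) + R·r^k·p₀`;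
  **`crnLag_replicas_burnIn_bernstein_abs_target_equilibrium`** — with `σ² = Var_π f + 3r^k(c − a)²`: THE BERNSTEIN BAR OF `R` INDEPENDENT
  EQUILIBRIUM MEASUREMENTS AT THE OBSERVABLE'S EQUILIBRIUM VARIANCE, up to `R·r^k·p₀` and the bias allowance `r^k(c − a)`; for small `ε`
  the exponent is `Rε²/(2Var_π f)·(1 + o(1))` — the rate of the central limit theorem of GEN-38 `…CLT` — where Hoeffding (GEN-39) gives
  `2Rε²/(c − a)²` (`Var_π f ≤ (c − a)²/4` always, typically `≪`).
Reading (gauge files): for `R` independent coupled pairs of two exact gauge samplers on one stream of random numbers, after `k` discarded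
updates the averaged coupled estimate of a bounded observable obeys the Bernstein bar of `R` independent equilibrium measurements with
the observable's equilibrium variance, up to `R(1 − A)^k` and `3(1 − A)^k(c − a)²`.
NOT CLAIMED: the untruncated estimator without the burn-in event (unbounded summands); an empirical-variance (data-driven `σ²`) certificate;
anything for unbounded `f` or any value of `A`.  No `sorry`, no new definitions, nothing cited as a fact.
-/

noncomputable section

namespace Summit.Ventures.LatticeQCDFlow.Exactness

open MeasureTheory ProbabilityTheory Function Finset Filter
open scoped ENNReal unitInterval Topology NNReal
open Summit.Ventures.LatticeQCDFlow.Scoring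

variable {Ω : Type*} [MeasurableSpace Ω] {q : Measure Ω} [IsProbabilityMeasure q] {w : Ω → ℝ}

/-! ## §1 The read-out variance is an equilibrium quantity; Bernstein for the read-outs -/

/-- **`Var_{μ₀Kⁿ} f ≤ Var_π f + 3rⁿ(c − a)²`** for every probability start `μ₀`, `a ≤ f ≤ c` measurable, `w` maximal at `x₀`,
`r = 1 − 1/w(x₀)` (second moment and mean of `f − a` are each within `rⁿ`·range of their equilibrium values). [ours] -/
theorem variance_iterate_bind_indepMH_le (hw : Measurable w) (hw0 : ∀ y, 0 < w y) {x₀ : Ω} (hmax : ∀ y, w y ≤ w x₀)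
    [IsProbabilityMeasure (q.withDensity fun y => ENNReal.ofReal (w y))]
    (n : ℕ) (μ₀ : Measure Ω) [IsProbabilityMeasure μ₀] {f : Ω → ℝ} (hf : Measurable f) {a c : ℝ}
    (ha : ∀ x, a ≤ f x) (hc : ∀ x, f x ≤ c) :
    variance f ((fun m : Measure Ω => m.bind (indepMH q w))^[n] μ₀) ≤
      variance f (q.withDensity fun y => ENNReal.ofReal (w y)) + 3 * ((1 - (w x₀)⁻¹) ^ n * (c - a) ^ 2) := by
  haveI : Fact (Measurable w) := ⟨hw⟩
  haveI := isProbabilityMeasure_iterate_bind (κ := indepMH q w) μ₀ n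
  set μn : Measure Ω := (fun m : Measure Ω => m.bind (indepMH q w))^[n] μ₀ with hμn
  set π : Measure Ω := q.withDensity fun y => ENNReal.ofReal (w y) with hπ
  set g : Ω → ℝ := fun x => f x - a with hg
  have hg0 : ∀ x, 0 ≤ g x := fun x => sub_nonneg.2 (ha x)
  have hgc : ∀ x, g x ≤ c - a := fun x => sub_le_sub_right (hc x) a
  have hgm : Measurable g := hf.sub_const a
  have hg2m : Measurable fun x => g x ^ 2 := hgm.pow_const 2
  have hg20 : ∀ x, 0 ≤ g x ^ 2 := fun x => sq_nonneg _
  have hg2c : ∀ x, g x ^ 2 ≤ (c - a) ^ 2 := fun x => pow_le_pow_left₀ (hg0 x) (hgc x) 2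
  have hvar : ∀ (m : Measure Ω) [IsProbabilityMeasure m], variance f m = variance g m := fun m _ => by
    rw [hg, variance_sub_const hf.aestronglyMeasurable]
  have hvg : ∀ (m : Measure Ω) [IsProbabilityMeasure m], variance g m = ∫ x, g x ^ 2 ∂m - (∫ x, g x ∂m) ^ 2 :=
    fun m _ => by
    rw [variance_eq_sub (memLp_of_bounded (a := 0) (b := c - a) (ae_of_all _ fun x => ⟨hg0 x, hgc x⟩)
      hgm.aestronglyMeasurable 2)]
    rfl
  have hmean_le : ∀ (m : Measure Ω) [IsProbabilityMeasure m], 0 ≤ ∫ x, g x ∂m ∧ ∫ x, g x ∂m ≤ c - a := fun m _ => by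
    refine ⟨integral_nonneg hg0, ?_⟩
    calc ∫ x, g x ∂m ≤ ∫ _, (c - a) ∂m :=
          integral_mono_of_nonneg (ae_of_all _ hg0) (integrable_const _) (ae_of_all _ hgc)
      _ = c - a := by simp
  have h1 : |∫ x, g x ^ 2 ∂μn - ∫ x, g x ^ 2 ∂π| ≤ (1 - (w x₀)⁻¹) ^ n * ((c - a) ^ 2 - 0) :=
    integral_iterate_bind_indepMH_abs_le hw hw0 hmax n μ₀ hg2m hg20 hg2c
  have h2 : |∫ x, g x ∂μn - ∫ x, g x ∂π| ≤ (1 - (w x₀)⁻¹) ^ n * ((c - a) - 0) :=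
    integral_iterate_bind_indepMH_abs_le hw hw0 hmax n μ₀ hgm hg0 hgc
  rw [sub_zero] at h1 h2
  rw [hvar μn, hvar π, hvg μn, hvg π]
  set r : ℝ := (1 - (w x₀)⁻¹) ^ n with hr
  set A := ∫ x, g x ∂μn with hA
  set B := ∫ x, g x ∂π with hB
  obtain ⟨hA0, hAc⟩ := hmean_le μn
  obtain ⟨hB0, hBc⟩ := hmean_le π
  have e1 : ∫ x, g x ^ 2 ∂μn - ∫ x, g x ^ 2 ∂π ≤ r * (c - a) ^ 2 := (abs_sub_le_iff.1 h1).1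
  have hδ0 : 0 ≤ r * (c - a) := (abs_nonneg _).trans h2
  have e2 : B - A ≤ r * (c - a) := (abs_sub_le_iff.1 h2).2
  have e3 : B ^ 2 - A ^ 2 ≤ r * (c - a) * (2 * (c - a)) :=
    calc B ^ 2 - A ^ 2 = (B - A) * (A + B) := by ring
      _ ≤ r * (c - a) * (A + B) := mul_le_mul_of_nonneg_right e2 (by linarith)
      _ ≤ r * (c - a) * (2 * (c - a)) := mul_le_mul_of_nonneg_left (by linarith) hδ0
  nlinarith

section Replicas

variable {Ω' : Type*} {mΩ' : MeasurableSpace Ω'} {μ : Measure Ω'} [IsProbabilityMeasure μ]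
  {Z : ℕ → Ω' → (ℕ → Ω × Ω)}

omit [IsProbabilityMeasure μ] in
/-- **THE READ-OUT VARIANCE ALONG A REPLICA IS `Var_{ν₂K^k} f`** (transfer along the common law of the pair chain). [ours, bookkeeping] -/
theorem crnLag_replica_readout_variance_eq [Fact (Measurable w)] (hw0 : ∀ y, 0 < w y)
    (Khat : Kernel (Ω × Ω) (Ω × Ω)) [IsMarkovKernel Khat]
    (hK : ∀ z : Ω × Ω, Khat z = (q.prod (volume : Measure unitInterval)).map (fun p : Ω × unitInterval =>
      ((if (p.2 : ℝ) * w z.1 ≤ w p.1 then p.1 else z.1), (if (p.2 : ℝ) * w z.2 ≤ w p.1 then p.1 else z.2))))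
    (ν : Measure (Ω × Ω)) [IsProbabilityMeasure ν] {f : Ω → ℝ} (hf : Measurable f) {a c : ℝ} (ha : ∀ x, a ≤ f x)
    (hc : ∀ x, f x ≤ c) (k : ℕ) {j : ℕ} (hZm : Measurable (Z j))
    (hlaw : μ.map (Z j) = Kernel.trajMeasure (X := fun _ : ℕ => Ω × Ω) ν
      (fun n : ℕ => Khat.comap (fun h : (i : ↥(Finset.Iic n)) → Ω × Ω => h ⟨n, Finset.mem_Iic.2 le_rfl⟩)
        (measurable_pi_apply _))) :
    variance (fun ω => f ((Z j ω k).2)) μ = variance f ((fun m : Measure Ω => m.bind (indepMH q w))^[k] (ν.map Prod.snd)) := by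
  haveI : IsProbabilityMeasure (ν.map Prod.snd) := Measure.isProbabilityMeasure_map measurable_snd.aemeasurable
  set mk := ∫ y, f y ∂((fun m : Measure Ω => m.bind (indepMH q w))^[k] (ν.map Prod.snd)) with hmk
  have hFm : Measurable fun z : ℕ → Ω × Ω => f ((z k).2) := hf.comp (measurable_snd.comp (measurable_pi_apply k))
  have hC : ∀ x, |f x| ≤ max |a| |c| := fun x => abs_le_max_abs_abs (ha x) (hc x)
  have hmean : μ[fun ω => f ((Z j ω k).2)] = mk := by
    rw [integral_comp_eq_of_map_eq hZm hlaw hFm]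
    exact crnLag_integral_snd_eq hw0 Khat hK ν hf hC k
  -- the centred square `(f − m_k)²` is bounded and measurable; transfer it the same way
  have hGm : Measurable fun x => (f x - mk) ^ 2 := (hf.sub_const mk).pow_const 2
  have hGC : ∀ x, |(f x - mk) ^ 2| ≤ (max |a| |c| + |mk|) ^ 2 := fun x => by
    rw [abs_pow]
    refine pow_le_pow_left₀ (abs_nonneg _) ?_ 2
    calc |f x - mk| ≤ |f x| + |mk| := abs_sub _ _
      _ ≤ max |a| |c| + |mk| := add_le_add (hC x) le_rfl
  have hGFm : Measurable fun z : ℕ → Ω × Ω => (f ((z k).2) - mk) ^ 2 := hGm.comp (measurable_snd.comp (measurable_pi_apply k))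
  rw [variance_eq_integral (X := fun ω => f ((Z j ω k).2)) (hFm.comp hZm).aemeasurable,
    variance_eq_integral hf.aemeasurable, hmean, ← hmk]
  rw [integral_comp_eq_of_map_eq hZm hlaw hGFm]
  exact crnLag_integral_snd_eq hw0 Khat hK ν (f := fun x => (f x - mk) ^ 2) hGm hGC k

/-- **BERNSTEIN FOR THE PLAIN READ-OUTS `f(Y_k^{(j)}) ∈ [a, c]`** across mutually independent pair streams with the common law of the
pair chain (`σ² ≥ Var_{ν₂K^k} f`, `σ² > 0`): `P(|R⁻¹Σ_{j<R} f(Y_k^{(j)}) − (ν₂K^k) f| ≥ ε) ≤ 2·exp(−Rε²/(2(σ² + (c − a)ε/3)))`. [ours] -/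
theorem crnLag_replicas_readout_bernstein_abs [Fact (Measurable w)] (hw0 : ∀ y, 0 < w y)
    (Khat : Kernel (Ω × Ω) (Ω × Ω)) [IsMarkovKernel Khat]
    (hK : ∀ z : Ω × Ω, Khat z = (q.prod (volume : Measure unitInterval)).map (fun p : Ω × unitInterval =>
      ((if (p.2 : ℝ) * w z.1 ≤ w p.1 then p.1 else z.1), (if (p.2 : ℝ) * w z.2 ≤ w p.1 then p.1 else z.2))))
    (ν : Measure (Ω × Ω)) [IsProbabilityMeasure ν] {f : Ω → ℝ} (hf : Measurable f) {a c : ℝ} (ha : ∀ x, a ≤ f x)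
    (hc : ∀ x, f x ≤ c) (k : ℕ) (hZm : ∀ j, Measurable (Z j))
    (hlaw : ∀ j, μ.map (Z j) = Kernel.trajMeasure (X := fun _ : ℕ => Ω × Ω) ν
      (fun n : ℕ => Khat.comap (fun h : (i : ↥(Finset.Iic n)) → Ω × Ω => h ⟨n, Finset.mem_Iic.2 le_rfl⟩)
        (measurable_pi_apply _)))
    (hind : iIndepFun Z μ) {σ2 : ℝ} (hσ : 0 < σ2)
    (hσk : variance f ((fun m : Measure Ω => m.bind (indepMH q w))^[k] (ν.map Prod.snd)) ≤ σ2)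
    {ε : ℝ} (hε : 0 ≤ ε) {R : ℕ} (hR : 1 ≤ R) :
    μ.real {ω | ε ≤ |(R : ℝ)⁻¹ * ∑ j ∈ range R, f ((Z j ω k).2) -
        ∫ y, f y ∂((fun m : Measure Ω => m.bind (indepMH q w))^[k] (ν.map Prod.snd))|} ≤
      2 * Real.exp (-(R * ε ^ 2) / (2 * (σ2 + (c - a) * ε / 3))) := by
  have hFm : Measurable fun z : ℕ → Ω × Ω => f ((z k).2) := hf.comp (measurable_snd.comp (measurable_pi_apply k))
  have hC : ∀ x, |f x| ≤ max |a| |c| := fun x => abs_le_max_abs_abs (ha x) (hc x)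
  set mk := ∫ y, f y ∂((fun m : Measure Ω => m.bind (indepMH q w))^[k] (ν.map Prod.snd)) with hmk
  have hmean : ∀ j, μ[fun ω => f ((Z j ω k).2)] = mk := fun j => by
    rw [integral_comp_eq_of_map_eq (hZm j) (hlaw j) hFm]
    exact crnLag_integral_snd_eq hw0 Khat hK ν hf hC k
  haveI : IsProbabilityMeasure (ν.map Prod.snd) := Measure.isProbabilityMeasure_map measurable_snd.aemeasurable
  haveI := isProbabilityMeasure_iterate_bind (κ := indepMH q w) (ν.map Prod.snd) k
  -- `m_k ∈ [a, c]`, so `|f − m_k| ≤ c − a`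
  have hmk_mem : a ≤ mk ∧ mk ≤ c := by
    constructor
    · calc a = ∫ _, a ∂((fun m : Measure Ω => m.bind (indepMH q w))^[k] (ν.map Prod.snd)) := by simp
        _ ≤ mk := integral_mono (integrable_const _)
            (Integrable.of_bound hf.aestronglyMeasurable (max |a| |c|) (ae_of_all _ fun x => by
              rw [Real.norm_eq_abs]; exact hC x)) ha
    · calc mk ≤ ∫ _, c ∂((fun m : Measure Ω => m.bind (indepMH q w))^[k] (ν.map Prod.snd)) :=
          integral_mono (Integrable.of_bound hf.aestronglyMeasurable (max |a| |c|) (ae_of_all _ fun x => by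
              rw [Real.norm_eq_abs]; exact hC x)) (integrable_const _) hc
        _ = c := by simp
  have hbd : ∀ j ω, |f ((Z j ω k).2) - mk| ≤ c - a := fun j ω =>
    abs_sub_le_iff.2 ⟨by linarith [hc (Z j ω k).2, hmk_mem.1], by linarith [ha (Z j ω k).2, hmk_mem.2]⟩
  have hvar : ∀ j, variance (fun ω => f ((Z j ω k).2)) μ ≤ σ2 := fun j => by
    rw [crnLag_replica_readout_variance_eq hw0 Khat hK ν hf ha hc k (hZm j) (hlaw j)]
    exact hσk
  exact bernstein_avg_abs (μ := μ) (X := fun j ω => f ((Z j ω k).2)) (fun j => hFm.comp (hZm j))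
    (hind.comp (fun _ => _) fun _ => hFm) hmean hbd hσ hvar hε hR

/-! ## §2 The burn-in Bernstein bar for the coupled estimator -/

/-- **`P(|H̄_R − (ν₂K^k) f| ≥ ε) ≤ 2·exp(−Rε²/(2(σ² + (c − a)ε/3))) + R·r^k·p₀`** for `ε ≥ 0`, `R ≥ 1`, every window `N`, every
`σ² ≥ Var_{ν₂K^k} f` with `σ² > 0`: off the event that some replica carries a correction the coupled average IS the read-out average. [ours] -/
theorem crnLag_replicas_burnIn_bernstein_abs [MeasurableEq Ω] [Fact (Measurable w)] (hw0 : ∀ y, 0 < w y) {x₀ : Ω}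
    (hmax : ∀ y, w y ≤ w x₀) [IsProbabilityMeasure (q.withDensity fun y => ENNReal.ofReal (w y))]
    (Khat : Kernel (Ω × Ω) (Ω × Ω)) [IsMarkovKernel Khat]
    (hK : ∀ z : Ω × Ω, Khat z = (q.prod (volume : Measure unitInterval)).map (fun p : Ω × unitInterval =>
      ((if (p.2 : ℝ) * w z.1 ≤ w p.1 then p.1 else z.1), (if (p.2 : ℝ) * w z.2 ≤ w p.1 then p.1 else z.2))))
    (ν : Measure (Ω × Ω)) [IsProbabilityMeasure ν] {f : Ω → ℝ} (hf : Measurable f) {a c : ℝ} (ha : ∀ x, a ≤ f x)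
    (hc : ∀ x, f x ≤ c) (k N : ℕ) (hZm : ∀ j, Measurable (Z j))
    (hlaw : ∀ j, μ.map (Z j) = Kernel.trajMeasure (X := fun _ : ℕ => Ω × Ω) ν
      (fun n : ℕ => Khat.comap (fun h : (i : ↥(Finset.Iic n)) → Ω × Ω => h ⟨n, Finset.mem_Iic.2 le_rfl⟩)
        (measurable_pi_apply _)))
    (hind : iIndepFun Z μ) {σ2 : ℝ} (hσ : 0 < σ2)
    (hσk : variance f ((fun m : Measure Ω => m.bind (indepMH q w))^[k] (ν.map Prod.snd)) ≤ σ2)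
    {ε : ℝ} (hε : 0 ≤ ε) {R : ℕ} (hR : 1 ≤ R) :
    μ.real {ω | ε ≤ |(R : ℝ)⁻¹ * ∑ j ∈ range R, (f ((Z j ω k).2) + ∑ n ∈ range N, (f ((Z j ω (k + n)).1) - f ((Z j ω (k + n)).2))) -
        ∫ y, f y ∂((fun m : Measure Ω => m.bind (indepMH q w))^[k] (ν.map Prod.snd))|} ≤
      2 * Real.exp (-(R * ε ^ 2) / (2 * (σ2 + (c - a) * ε / 3))) + R * ((1 - (w x₀)⁻¹) ^ k * ν.real (Set.diagonal Ω)ᶜ) := by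
  set mk := ∫ y, f y ∂((fun m : Measure Ω => m.bind (indepMH q w))^[k] (ν.map Prod.snd)) with hmk
  set B : Set Ω' := ⋃ j ∈ range R, {ω | ∑ n ∈ range N, (f ((Z j ω (k + n)).1) - f ((Z j ω (k + n)).2)) ≠ 0} with hB
  have hsub : {ω | ε ≤ |(R : ℝ)⁻¹ * ∑ j ∈ range R, (f ((Z j ω k).2) + ∑ n ∈ range N, (f ((Z j ω (k + n)).1) - f ((Z j ω (k + n)).2))) - mk|}
      ⊆ B ∪ {ω | ε ≤ |(R : ℝ)⁻¹ * ∑ j ∈ range R, f ((Z j ω k).2) - mk|} := by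
    intro ω hω
    by_cases hωB : ω ∈ B
    · exact Or.inl hωB
    · right
      have hzero : ∀ j ∈ range R, ∑ n ∈ range N, (f ((Z j ω (k + n)).1) - f ((Z j ω (k + n)).2)) = 0 := by
        intro j hj
        by_contra hne
        exact hωB (Set.mem_biUnion (show j ∈ (range R : Set ℕ) from by exact_mod_cast hj) hne)
      have hsum : ∑ j ∈ range R, (f ((Z j ω k).2) + ∑ n ∈ range N, (f ((Z j ω (k + n)).1) - f ((Z j ω (k + n)).2))) =
          ∑ j ∈ range R, f ((Z j ω k).2) := sum_congr rfl fun j hj => by rw [hzero j hj, add_zero]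
      simp only [Set.mem_setOf_eq] at hω ⊢
      rwa [hsum] at hω
  have h1 := crnLag_replicas_some_correction_le hw0 hmax Khat hK ν hf ha hc k N hZm hlaw R
  have h2 := crnLag_replicas_readout_bernstein_abs hw0 Khat hK ν hf ha hc k hZm hlaw hind hσ hσk hε hR
  calc μ.real {ω | ε ≤ |(R : ℝ)⁻¹ * ∑ j ∈ range R, (f ((Z j ω k).2) + ∑ n ∈ range N, (f ((Z j ω (k + n)).1) - f ((Z j ω (k + n)).2))) - mk|}
      ≤ μ.real (B ∪ {ω | ε ≤ |(R : ℝ)⁻¹ * ∑ j ∈ range R, f ((Z j ω k).2) - mk|}) := measureReal_mono hsub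
    _ ≤ μ.real B + μ.real {ω | ε ≤ |(R : ℝ)⁻¹ * ∑ j ∈ range R, f ((Z j ω k).2) - mk|} := measureReal_union_le _ _
    _ ≤ 2 * Real.exp (-(R * ε ^ 2) / (2 * (σ2 + (c - a) * ε / 3))) + R * ((1 - (w x₀)⁻¹) ^ k * ν.real (Set.diagonal Ω)ᶜ) := by
        linarith

/-- **BURN-IN BUYS THE EQUILIBRIUM BERNSTEIN BAR — ABOUT `π f` ITSELF**: for `ε ≥ 0`, `R ≥ 1`, every window `N` and every `σ² ≥ Var_{ν₂K^k} f`
with `σ² > 0`: `P(|H̄_R − π f| ≥ ε + r^k(c − a)) ≤ 2·exp(−Rε²/(2(σ² + (c − a)ε/3))) + R·r^k·p₀`. [ours] -/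
theorem crnLag_replicas_burnIn_bernstein_abs_target [MeasurableEq Ω] [Fact (Measurable w)] (hw0 : ∀ y, 0 < w y) {x₀ : Ω}
    (hmax : ∀ y, w y ≤ w x₀) [IsProbabilityMeasure (q.withDensity fun y => ENNReal.ofReal (w y))]
    (Khat : Kernel (Ω × Ω) (Ω × Ω)) [IsMarkovKernel Khat]
    (hK : ∀ z : Ω × Ω, Khat z = (q.prod (volume : Measure unitInterval)).map (fun p : Ω × unitInterval =>
      ((if (p.2 : ℝ) * w z.1 ≤ w p.1 then p.1 else z.1), (if (p.2 : ℝ) * w z.2 ≤ w p.1 then p.1 else z.2))))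
    (ν : Measure (Ω × Ω)) [IsProbabilityMeasure ν] {f : Ω → ℝ} (hf : Measurable f) {a c : ℝ} (ha : ∀ x, a ≤ f x)
    (hc : ∀ x, f x ≤ c) (k N : ℕ) (hZm : ∀ j, Measurable (Z j))
    (hlaw : ∀ j, μ.map (Z j) = Kernel.trajMeasure (X := fun _ : ℕ => Ω × Ω) ν
      (fun n : ℕ => Khat.comap (fun h : (i : ↥(Finset.Iic n)) → Ω × Ω => h ⟨n, Finset.mem_Iic.2 le_rfl⟩)
        (measurable_pi_apply _)))
    (hind : iIndepFun Z μ) {σ2 : ℝ} (hσ : 0 < σ2)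
    (hσk : variance f ((fun m : Measure Ω => m.bind (indepMH q w))^[k] (ν.map Prod.snd)) ≤ σ2)
    {ε : ℝ} (hε : 0 ≤ ε) {R : ℕ} (hR : 1 ≤ R) :
    μ.real {ω | ε + (1 - (w x₀)⁻¹) ^ k * (c - a) ≤
        |(R : ℝ)⁻¹ * ∑ j ∈ range R, (f ((Z j ω k).2) + ∑ n ∈ range N, (f ((Z j ω (k + n)).1) - f ((Z j ω (k + n)).2))) -
          ∫ x, f x ∂(q.withDensity fun y => ENNReal.ofReal (w y))|} ≤
      2 * Real.exp (-(R * ε ^ 2) / (2 * (σ2 + (c - a) * ε / 3))) + R * ((1 - (w x₀)⁻¹) ^ k * ν.real (Set.diagonal Ω)ᶜ) := by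
  have hw : Measurable w := Fact.out
  haveI : IsProbabilityMeasure (ν.map Prod.snd) := Measure.isProbabilityMeasure_map measurable_snd.aemeasurable
  set mk := ∫ y, f y ∂((fun m : Measure Ω => m.bind (indepMH q w))^[k] (ν.map Prod.snd)) with hmk
  set πf := ∫ x, f x ∂(q.withDensity fun y => ENNReal.ofReal (w y)) with hπf
  set X : ℕ → Ω' → ℝ := fun j ω => f ((Z j ω k).2) + ∑ n ∈ range N, (f ((Z j ω (k + n)).1) - f ((Z j ω (k + n)).2)) with hX
  have hbias : |mk - πf| ≤ (1 - (w x₀)⁻¹) ^ k * (c - a) := integral_iterate_bind_indepMH_abs_le hw hw0 hmax k (ν.map Prod.snd) hf ha hc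
  have h := crnLag_replicas_burnIn_bernstein_abs hw0 hmax Khat hK ν hf ha hc k N hZm hlaw hind hσ hσk hε hR
  have hsub : {ω | ε + (1 - (w x₀)⁻¹) ^ k * (c - a) ≤ |(R : ℝ)⁻¹ * ∑ j ∈ range R, X j ω - πf|} ⊆
      {ω | ε ≤ |(R : ℝ)⁻¹ * ∑ j ∈ range R, X j ω - mk|} := by
    intro ω hω
    simp only [Set.mem_setOf_eq] at hω ⊢
    have htri : |(R : ℝ)⁻¹ * ∑ j ∈ range R, X j ω - πf| ≤ |(R : ℝ)⁻¹ * ∑ j ∈ range R, X j ω - mk| + |mk - πf| :=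
      abs_sub_le ((R : ℝ)⁻¹ * ∑ j ∈ range R, X j ω) mk πf
    linarith
  show μ.real {ω | ε + (1 - (w x₀)⁻¹) ^ k * (c - a) ≤ |(R : ℝ)⁻¹ * ∑ j ∈ range R, X j ω - πf|} ≤ _
  exact (measureReal_mono hsub).trans h

/-- **THE EQUILIBRIUM-VARIANCE CERTIFICATE**: with `σ² = Var_π f + 3r^k(c − a)²` (assumed positive), for `ε ≥ 0`, `R ≥ 1`, every `N`:
`P(|H̄_R − π f| ≥ ε + r^k(c − a)) ≤ 2·exp(−Rε²/(2(Var_π f + 3r^k(c − a)² + (c − a)ε/3))) + R·r^k·p₀` — the Bernstein bar of `R`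
independent equilibrium measurements at the observable's equilibrium variance, up to terms geometric in the burn-in `k`. [ours] -/
theorem crnLag_replicas_burnIn_bernstein_abs_target_equilibrium [MeasurableEq Ω] [Fact (Measurable w)] (hw0 : ∀ y, 0 < w y)
    {x₀ : Ω} (hmax : ∀ y, w y ≤ w x₀) [IsProbabilityMeasure (q.withDensity fun y => ENNReal.ofReal (w y))]
    (Khat : Kernel (Ω × Ω) (Ω × Ω)) [IsMarkovKernel Khat]
    (hK : ∀ z : Ω × Ω, Khat z = (q.prod (volume : Measure unitInterval)).map (fun p : Ω × unitInterval =>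
      ((if (p.2 : ℝ) * w z.1 ≤ w p.1 then p.1 else z.1), (if (p.2 : ℝ) * w z.2 ≤ w p.1 then p.1 else z.2))))
    (ν : Measure (Ω × Ω)) [IsProbabilityMeasure ν] {f : Ω → ℝ} (hf : Measurable f) {a c : ℝ} (ha : ∀ x, a ≤ f x)
    (hc : ∀ x, f x ≤ c) (k N : ℕ) (hZm : ∀ j, Measurable (Z j))
    (hlaw : ∀ j, μ.map (Z j) = Kernel.trajMeasure (X := fun _ : ℕ => Ω × Ω) ν
      (fun n : ℕ => Khat.comap (fun h : (i : ↥(Finset.Iic n)) → Ω × Ω => h ⟨n, Finset.mem_Iic.2 le_rfl⟩)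
        (measurable_pi_apply _)))
    (hind : iIndepFun Z μ)
    (hpos : 0 < variance f (q.withDensity fun y => ENNReal.ofReal (w y)) + 3 * ((1 - (w x₀)⁻¹) ^ k * (c - a) ^ 2))
    {ε : ℝ} (hε : 0 ≤ ε) {R : ℕ} (hR : 1 ≤ R) :
    μ.real {ω | ε + (1 - (w x₀)⁻¹) ^ k * (c - a) ≤
        |(R : ℝ)⁻¹ * ∑ j ∈ range R, (f ((Z j ω k).2) + ∑ n ∈ range N, (f ((Z j ω (k + n)).1) - f ((Z j ω (k + n)).2))) -
          ∫ x, f x ∂(q.withDensity fun y => ENNReal.ofReal (w y))|} ≤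
      2 * Real.exp (-(R * ε ^ 2) / (2 * (variance f (q.withDensity fun y => ENNReal.ofReal (w y)) +
          3 * ((1 - (w x₀)⁻¹) ^ k * (c - a) ^ 2) + (c - a) * ε / 3))) +
        R * ((1 - (w x₀)⁻¹) ^ k * ν.real (Set.diagonal Ω)ᶜ) := by
  haveI : IsProbabilityMeasure (ν.map Prod.snd) := Measure.isProbabilityMeasure_map measurable_snd.aemeasurable
  have hσk := variance_iterate_bind_indepMH_le (q := q) Fact.out hw0 hmax k (ν.map Prod.snd) hf ha hc
  exact crnLag_replicas_burnIn_bernstein_abs_target hw0 hmax Khat hK ν hf ha hc k N hZm hlaw hind hpos hσk hε hR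

/-! ## §3 The sample-size recipe (numbers) -/

omit [MeasurableSpace Ω] [IsProbabilityMeasure q] in
/-- `2(σ² + bε/3)·log(4/δ) ≤ Rε²` (`σ² + bε/3 > 0`, `δ > 0`) ⇒ `2·exp(−Rε²/(2(σ² + bε/3))) ≤ δ/2`. [ours, bookkeeping] -/
theorem two_mul_exp_bernstein_le_of_log_le {σ2 b ε δ : ℝ} (hD : 0 < σ2 + b * ε / 3) (hδ : 0 < δ) {R : ℕ}
    (hR : 2 * (σ2 + b * ε / 3) * Real.log (4 / δ) ≤ R * ε ^ 2) :
    2 * Real.exp (-(R * ε ^ 2) / (2 * (σ2 + b * ε / 3))) ≤ δ / 2 := by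
  have h1 : Real.log (4 / δ) ≤ R * ε ^ 2 / (2 * (σ2 + b * ε / 3)) := by
    rw [le_div_iff₀ (by positivity)]; linarith
  have h2 : Real.exp (-(R * ε ^ 2) / (2 * (σ2 + b * ε / 3))) ≤ δ / 4 := by
    calc Real.exp (-(R * ε ^ 2) / (2 * (σ2 + b * ε / 3))) ≤ Real.exp (-Real.log (4 / δ)) := by
          rw [neg_div]; exact Real.exp_le_exp.2 (neg_le_neg h1)
      _ = δ / 4 := by rw [Real.exp_neg, Real.exp_log (by positivity), inv_div]
  linarith

/-- **THE BERNSTEIN SAMPLE-SIZE RECIPE FOR THE COUPLED ESTIMATOR.**  `w` a `Fact`-measurable normalised weight maximal at `x₀` (`W = w(x₀)`,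
`A = 1/W`); `MeasurableEq Ω`; `K̂` a CRN pair kernel; `Z_0, Z_1, …` mutually independent pair streams from ONE initial coupling `ν̂` one update
ahead, `p₀ = ν̂(Δᶜ)`; `a ≤ f ≤ c` measurable with `a < c`; a variance bound `σ² ≥ Var_{ν₂K^k} f`, `σ² > 0` (e.g. `Var_π f + 3r^k(c − a)²`,
`variance_iterate_bind_indepMH_le`); accuracy `ε > 0`, risk `δ > 0`; `R ≥ 1` pairs with `2(σ² + (c − a)ε/3)·log(4/δ) ≤ Rε²`; burn-in `k`
with `log((c − a)/ε) ≤ k·A` and `p₀ = 0 ∨ log(2R·p₀/δ) ≤ k·A`.  Then, for every window `N`, `P(|R⁻¹Σ_{j<R} H_{k,N}(Z_j) − π f| ≥ 2ε) ≤ δ`: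
`R = ⌈2(σ² + (c − a)ε/3)·log(4/δ)/ε²⌉` pairs — THE VARIANCE, NOT THE SQUARED RANGE, PER `ε²` — and `k = ⌈W·max(log((c − a)/ε), log(2Rp₀/δ))⌉`
burn-in updates. [ours] -/
theorem crnLag_replicas_bernstein_budget [MeasurableEq Ω] [Fact (Measurable w)] (hw0 : ∀ y, 0 < w y) {x₀ : Ω}
    (hmax : ∀ y, w y ≤ w x₀) [IsProbabilityMeasure (q.withDensity fun y => ENNReal.ofReal (w y))]
    (Khat : Kernel (Ω × Ω) (Ω × Ω)) [IsMarkovKernel Khat]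
    (hK : ∀ z : Ω × Ω, Khat z = (q.prod (volume : Measure unitInterval)).map (fun p : Ω × unitInterval =>
      ((if (p.2 : ℝ) * w z.1 ≤ w p.1 then p.1 else z.1), (if (p.2 : ℝ) * w z.2 ≤ w p.1 then p.1 else z.2))))
    (ν : Measure (Ω × Ω)) [IsProbabilityMeasure ν] {f : Ω → ℝ} (hf : Measurable f) {a c : ℝ} (ha : ∀ x, a ≤ f x)
    (hc : ∀ x, f x ≤ c) (hac : a < c) (k N : ℕ) (hZm : ∀ j, Measurable (Z j))
    (hlaw : ∀ j, μ.map (Z j) = Kernel.trajMeasure (X := fun _ : ℕ => Ω × Ω) ν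
      (fun n : ℕ => Khat.comap (fun h : (i : ↥(Finset.Iic n)) → Ω × Ω => h ⟨n, Finset.mem_Iic.2 le_rfl⟩)
        (measurable_pi_apply _)))
    (hind : iIndepFun Z μ) {σ2 : ℝ} (hσ : 0 < σ2)
    (hσk : variance f ((fun m : Measure Ω => m.bind (indepMH q w))^[k] (ν.map Prod.snd)) ≤ σ2)
    {ε δ : ℝ} (hε : 0 < ε) (hδ : 0 < δ) {R : ℕ} (hR : 1 ≤ R)
    (hRε : 2 * (σ2 + (c - a) * ε / 3) * Real.log (4 / δ) ≤ R * ε ^ 2)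
    (hkε : Real.log ((c - a) / ε) ≤ k * (w x₀)⁻¹)
    (hkδ : ν.real (Set.diagonal Ω)ᶜ = 0 ∨ Real.log (2 * R * ν.real (Set.diagonal Ω)ᶜ / δ) ≤ k * (w x₀)⁻¹) :
    μ.real {ω | 2 * ε ≤
        |(R : ℝ)⁻¹ * ∑ j ∈ range R, (f ((Z j ω k).2) + ∑ n ∈ range N, (f ((Z j ω (k + n)).1) - f ((Z j ω (k + n)).2))) -
          ∫ x, f x ∂(q.withDensity fun y => ENNReal.ofReal (w y))|} ≤ δ := by
  have hW : 1 ≤ w x₀ := one_le_of_mode (q := q) hmax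
  have hca : 0 < c - a := sub_pos.2 hac
  have hRpos : (0 : ℝ) < R := Nat.cast_pos.2 (by omega)
  -- (i) the bias allowance: `r^k (c − a) ≤ ε`
  have hbias : (1 - (w x₀)⁻¹) ^ k * (c - a) ≤ ε := by
    have h := one_sub_inv_pow_le_of_log_le hW (div_pos hε hca) (k := k) (by rwa [one_div, inv_div])
    calc (1 - (w x₀)⁻¹) ^ k * (c - a) ≤ ε / (c - a) * (c - a) := mul_le_mul_of_nonneg_right h hca.le
      _ = ε := div_mul_cancel₀ ε hca.ne'
  -- (ii) the Bernstein term: `2·exp(−Rε²/(2(σ² + (c − a)ε/3))) ≤ δ/2`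
  have hexp : 2 * Real.exp (-(R * ε ^ 2) / (2 * (σ2 + (c - a) * ε / 3))) ≤ δ / 2 :=
    two_mul_exp_bernstein_le_of_log_le (by positivity) hδ hRε
  -- (iii) the coupling term: `R·r^k·p₀ ≤ δ/2`
  have hcoup : R * ((1 - (w x₀)⁻¹) ^ k * ν.real (Set.diagonal Ω)ᶜ) ≤ δ / 2 := by
    rcases hkδ with h0 | hlog
    · rw [h0, mul_zero, mul_zero]; linarith
    · rcases (measureReal_nonneg (μ := ν) (s := (Set.diagonal Ω)ᶜ)).lt_or_eq with hp | hp
      · have hy : 0 < δ / (2 * R * ν.real (Set.diagonal Ω)ᶜ) := by positivity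
        have h := one_sub_inv_pow_le_of_log_le hW hy (k := k) (by rwa [one_div, inv_div])
        calc R * ((1 - (w x₀)⁻¹) ^ k * ν.real (Set.diagonal Ω)ᶜ)
            = (1 - (w x₀)⁻¹) ^ k * (R * ν.real (Set.diagonal Ω)ᶜ) := by ring
          _ ≤ δ / (2 * R * ν.real (Set.diagonal Ω)ᶜ) * (R * ν.real (Set.diagonal Ω)ᶜ) :=
              mul_le_mul_of_nonneg_right h (mul_nonneg hRpos.le hp.le)
          _ = δ / 2 := by field_simp
      · rw [← hp, mul_zero, mul_zero]; linarith
  have hsub : {ω | 2 * ε ≤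
        |(R : ℝ)⁻¹ * ∑ j ∈ range R, (f ((Z j ω k).2) + ∑ n ∈ range N, (f ((Z j ω (k + n)).1) - f ((Z j ω (k + n)).2))) -
          ∫ x, f x ∂(q.withDensity fun y => ENNReal.ofReal (w y))|} ⊆
      {ω | ε + (1 - (w x₀)⁻¹) ^ k * (c - a) ≤
        |(R : ℝ)⁻¹ * ∑ j ∈ range R, (f ((Z j ω k).2) + ∑ n ∈ range N, (f ((Z j ω (k + n)).1) - f ((Z j ω (k + n)).2))) -
          ∫ x, f x ∂(q.withDensity fun y => ENNReal.ofReal (w y))|} := fun ω hω => by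
    simp only [Set.mem_setOf_eq] at hω ⊢; linarith
  have h := crnLag_replicas_burnIn_bernstein_abs_target hw0 hmax Khat hK ν hf ha hc k N hZm hlaw hind hσ hσk hε.le hR
  calc μ.real {ω | 2 * ε ≤
          |(R : ℝ)⁻¹ * ∑ j ∈ range R, (f ((Z j ω k).2) + ∑ n ∈ range N, (f ((Z j ω (k + n)).1) - f ((Z j ω (k + n)).2))) -
            ∫ x, f x ∂(q.withDensity fun y => ENNReal.ofReal (w y))|}
      ≤ μ.real {ω | ε + (1 - (w x₀)⁻¹) ^ k * (c - a) ≤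
          |(R : ℝ)⁻¹ * ∑ j ∈ range R, (f ((Z j ω k).2) + ∑ n ∈ range N, (f ((Z j ω (k + n)).1) - f ((Z j ω (k + n)).2))) -
            ∫ x, f x ∂(q.withDensity fun y => ENNReal.ofReal (w y))|} := measureReal_mono hsub
    _ ≤ 2 * Real.exp (-(R * ε ^ 2) / (2 * (σ2 + (c - a) * ε / 3))) + R * ((1 - (w x₀)⁻¹) ^ k * ν.real (Set.diagonal Ω)ᶜ) := h
    _ ≤ δ := by linarith

end Replicas

end Summit.Ventures.LatticeQCDFlow.Exactness

end
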